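import Summits.ValiantsHypothesis.ValiantsHypothesis.Theorems.KPlusLogSqLawTridiagonalRealStaticSlopeSumRow
import Summits.ValiantsHypothesis.ValiantsHypothesis.Theorems.KPlusLogSqLawTridiagonalRealStaticLadderMoves
import Summits.ValiantsHypothesis.ValiantsHypothesis.Theorems.LacunarySymmetroidMatrixDescartesCensusNineteenKit

/-!
# Route «KPlusLogSqLaw», crux `WeakLifting` (stmt-ValiantsHypothesis-19561) — REAL side of the tridiagonal sector:
# FIXED-SLOPE STEPS for the equal-speed family — a small new link adds one certified sign alternation, at `+∞` or at `0⁺` (pure real analysis)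

HONEST FRAMING.  Helper (`--supports stmt-ValiantsHypothesis-19561 --as helper`), seat val-sym-lift-p2 (g16), cell `pub-symmetroid`,
2026-08-28; α register (static definite symmetric tridiagonal row `B m`), EQUAL-SPEED SECTOR, lower side.  This is the analytic half of the
all-sizes equal-speed row (`…TridiagonalRealStaticEqualSpeedAll`, same seat): two STEP LEMMAS in the sign-chain style of val-sym-lift-p1's
ladder (`…RealStaticLadderMoves`), but with a FIXED exponent and a SMALL coefficient instead of a steep exponent — which is what keeps the
designs inside the equal-speed sector.  No interlacing information about the previous continuant is needed: a small enough new link leaves the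
old sign chain untouched, and degree (resp. order-of-vanishing) dominance puts one new sign change beyond (resp. below) the old cluster.
* `exists_coeff_top` / `step_top` — `r = X·p − c·X⁴·q` with `deg(X·p) < deg(X⁴·q)`: for a suitable `c > 0` and a far point `P`, `r` copies the signs of
  `p` on the chain and `r(P) ≁ q(P) ~ lc q`; if `p(last) ~ lc p ~ lc q` the chain of `p` extends by `P`.
* `exists_coeff_bot` / `step_bot` — `s = X·r − c·p` with `p = X·p₁`, `p₁(0) ≠ 0`, `r = X²·r₁`: for a suitable `c > 0` and a small point `Q`, `s` copies the
  signs of `r` on the chain and `s(Q) ≁ p₁(0)`; if `r(first) ~ p₁(0)` the chain of `r` extends by `Q` in front.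
* bookkeeping: `eventually_leadingCoeff_mul_eval_pos` (eventual sign = sign of the leading coefficient), `isChain_append_singleton`; sign transfer is the
  tree's (`Census.mul_neg_of_mul_pos_of_mul_neg`, `Census.mul_neg_of_mul_neg_of_mul_pos`, `Literature…PlanarFoliations.mul_pos_of_mul_pos_of_mul_pos`).
Nothing here is an upper bound; nothing bears on `WeakLifting` / `TropicalB` (stmt-19771) in their windows, on Conjecture B, on the Door-A registers, on
`MatrixDescartes` (stmt-ValiantsHypothesis-18050) or on VP ≠ VNP.  [folklore: elementary real analysis (limits of rational functions, intermediate values)]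
-/
set_option linter.dupNamespace false
set_option autoImplicit false

namespace Summit.ValiantsHypothesis.ValiantsHypothesis.Theorems.KPlusLogSqLaw

namespace SlopeSumRow

open Polynomial Finset Filter Topology
open Summit.ValiantsHypothesis.ValiantsHypothesis.Theorems.KPlusLogSqLaw.StaticTridiagonalRealPotential
  (pathDet pathDet_zero pathDet_one pathDet_add_two pathDet_congr)
open Summit.ValiantsHypothesis.ValiantsHypothesis.Theorems.KPlusLogSqLaw.StaticTridiagonalRealLadder
  (le_card_posRoots_of_isChain isChain_alt_congr)
open Summit.ValiantsHypothesis.ValiantsHypothesis.Theorems.LacunarySymmetroidMatrixDescartes.Census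
  (mul_neg_of_mul_pos_of_mul_neg mul_neg_of_mul_neg_of_mul_pos)
open Literature.Topology.PlanarFoliations (mul_pos_of_mul_pos_of_mul_pos)

/-! ## 1. Analytic cores: a small new link creates one sign change far out (`+∞`) or far in (`0⁺`) -/

/-- Eventually (at `+∞`) a non-zero real polynomial has the sign of its leading coefficient. [folklore] -/
theorem eventually_leadingCoeff_mul_eval_pos (q : ℝ[X]) (hq : q ≠ 0) :
    ∀ᶠ x in atTop, 0 < q.leadingCoeff * q.eval x := by
  by_cases hdeg : 0 < q.degree
  · have hP : 0 < (C q.leadingCoeff * q).degree := by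
      rwa [degree_C_mul (leadingCoeff_ne_zero.mpr hq)]
    have hlc : 0 ≤ (C q.leadingCoeff * q).leadingCoeff := by
      rw [leadingCoeff_mul, leadingCoeff_C]; exact mul_self_nonneg _
    have h := Polynomial.tendsto_atTop_of_leadingCoeff_nonneg (C q.leadingCoeff * q) hP hlc
    filter_upwards [h.eventually_gt_atTop 0] with x hx
    simpa [eval_mul, eval_C] using hx
  · have h0 : q.degree ≤ 0 := not_lt.mp hdeg
    have hqC : q = C (q.coeff 0) := eq_C_of_degree_le_zero h0
    have hlc : q.leadingCoeff = q.coeff 0 := by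
      rw [hqC, leadingCoeff_C, coeff_C_zero]
    have hc0 : q.coeff 0 ≠ 0 := by
      intro h; apply hq; rw [hqC, h, map_zero]
    refine Filter.Eventually.of_forall fun x => ?_
    have hev : q.eval x = q.coeff 0 := by
      conv_lhs => rw [hqC]
      rw [eval_C]
    rw [hlc, hev]
    exact mul_self_pos.mpr hc0

/-- **`+∞` core.**  `p, q` real polynomials with `deg(X·p) < deg(X⁴·q)`; `T` a finite set of positive points where `p ≠ 0`.  Then there are `c > 0` and a point
`P` beyond any prescribed bound with: `c·x⁴|q(x)| < x·|p(x)|` on `T` (the new link is invisible on `T`), `P·|p(P)| < c·P⁴|q(P)|` (it dominates at `P`), and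
`q(P)` of the sign of `q`'s leading coefficient. [elementary analysis] -/
theorem exists_coeff_top (p q : ℝ[X]) (hq : q ≠ 0) (hdeg : (X * p).degree < (X ^ 4 * q).degree)
    (T : Finset ℝ) (hT : ∀ x ∈ T, 0 < x ∧ p.eval x ≠ 0) (M : ℝ) :
    ∃ c P : ℝ, 0 < c ∧ M < P ∧ 0 < P ∧
      (∀ x ∈ T, c * x ^ 4 * |q.eval x| < x * |p.eval x|) ∧
      P * |p.eval P| < c * P ^ 4 * |q.eval P| ∧
      0 < q.leadingCoeff * q.eval P := by
  -- the budget on `T`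
  set S : ℝ := ∑ x ∈ T, x ^ 4 * |q.eval x| / (x * |p.eval x|) with hS
  have hSnn : 0 ≤ S := Finset.sum_nonneg fun x hx => by
    obtain ⟨hx0, hpx⟩ := hT x hx
    positivity
  set c : ℝ := 1 / (2 * (1 + S)) with hc
  have hcpos : 0 < c := by rw [hc]; positivity
  have hsmall : ∀ x ∈ T, c * x ^ 4 * |q.eval x| < x * |p.eval x| := by
    intro x hx
    obtain ⟨hx0, hpx⟩ := hT x hx
    have hden : 0 < x * |p.eval x| := mul_pos hx0 (abs_pos.mpr hpx)
    have hterm : x ^ 4 * |q.eval x| / (x * |p.eval x|) ≤ S :=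
      Finset.single_le_sum (f := fun x => x ^ 4 * |q.eval x| / (x * |p.eval x|))
        (fun y hy => by obtain ⟨hy0, hpy⟩ := hT y hy; positivity) hx
    have h1 : x ^ 4 * |q.eval x| ≤ S * (x * |p.eval x|) := (div_le_iff₀ hden).mp hterm
    have h2 : c * (S * (x * |p.eval x|)) < x * |p.eval x| := by
      rw [hc]
      have : 1 / (2 * (1 + S)) * S < 1 := by
        rw [div_mul_eq_mul_div, one_mul, div_lt_one (by positivity)]; linarith
      nlinarith
    calc c * x ^ 4 * |q.eval x| = c * (x ^ 4 * |q.eval x|) := by ring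
      _ ≤ c * (S * (x * |p.eval x|)) := mul_le_mul_of_nonneg_left h1 hcpos.le
      _ < x * |p.eval x| := h2
  -- the ratio tends to zero, `q` takes the sign of its leading coefficient eventually
  have hratio := Polynomial.div_tendsto_atTop_zero_of_degree_lt (X * p) (X ^ 4 * q) hdeg
  have hev1 : ∀ᶠ x in atTop, |eval x (X * p) / eval x (X ^ 4 * q)| < c := by
    have := (Metric.tendsto_nhds.mp hratio) c hcpos
    filter_upwards [this] with x hx
    rw [Real.dist_eq, sub_zero] at hx
    exact hx
  have hev2 := eventually_leadingCoeff_mul_eval_pos q hq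
  obtain ⟨P, hP⟩ := (hev1.and (hev2.and ((eventually_gt_atTop M).and (eventually_gt_atTop 0)))).exists
  obtain ⟨hP1, hP2, hPM, hP0⟩ := hP
  refine ⟨c, P, hcpos, hPM, hP0, hsmall, ?_, hP2⟩
  have hqP : q.eval P ≠ 0 := by
    intro h; rw [h, mul_zero] at hP2; exact lt_irrefl 0 hP2
  have hden : 0 < P ^ 4 * |q.eval P| := mul_pos (pow_pos hP0 4) (abs_pos.mpr hqP)
  have hP1' : |P * p.eval P| / (P ^ 4 * |q.eval P|) < c := by
    have e : |eval P (X * p) / eval P (X ^ 4 * q)| = |P * p.eval P| / (P ^ 4 * |q.eval P|) := by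
      rw [eval_mul, eval_X, eval_mul, eval_pow, eval_X, abs_div, abs_mul (P ^ 4), abs_of_pos (pow_pos hP0 4)]
    rw [← e]; exact hP1
  rw [div_lt_iff₀ hden, abs_mul, abs_of_pos hP0] at hP1'
  linarith

/-- **`0⁺` core.**  `p = X·p₁` with `p₁(0) ≠ 0`, `r = X²·r₁`; `T` a finite set of positive points where `r ≠ 0`.  Then there are `c > 0` and a point `Q` below
any prescribed positive bound with: `c·|p(x)| < x·|r(x)|` on `T`, `Q·|r(Q)| < c·|p(Q)|`, and `p₁(Q)` of the sign of `p₁(0)`. [elementary analysis] -/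
theorem exists_coeff_bot (p₁ r₁ : ℝ[X]) (hp₁ : p₁.eval 0 ≠ 0)
    (T : Finset ℝ) (hT : ∀ x ∈ T, 0 < x ∧ (X ^ 2 * r₁).eval x ≠ 0) (m₀ : ℝ) (hm₀ : 0 < m₀) :
    ∃ c Q : ℝ, 0 < c ∧ 0 < Q ∧ Q < m₀ ∧
      (∀ x ∈ T, c * |(X * p₁).eval x| < x * |(X ^ 2 * r₁).eval x|) ∧
      Q * |(X ^ 2 * r₁).eval Q| < c * |(X * p₁).eval Q| ∧
      0 < p₁.eval 0 * p₁.eval Q := by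
  set S : ℝ := ∑ x ∈ T, |(X * p₁).eval x| / (x * |(X ^ 2 * r₁).eval x|) with hS
  have hSnn : 0 ≤ S := Finset.sum_nonneg fun x hx => by
    obtain ⟨hx0, hrx⟩ := hT x hx
    positivity
  set c : ℝ := 1 / (2 * (1 + S)) with hc
  have hcpos : 0 < c := by rw [hc]; positivity
  have hsmall : ∀ x ∈ T, c * |(X * p₁).eval x| < x * |(X ^ 2 * r₁).eval x| := by
    intro x hx
    obtain ⟨hx0, hrx⟩ := hT x hx
    have hden : 0 < x * |(X ^ 2 * r₁).eval x| := mul_pos hx0 (abs_pos.mpr hrx)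
    have hterm : |(X * p₁).eval x| / (x * |(X ^ 2 * r₁).eval x|) ≤ S :=
      Finset.single_le_sum (f := fun x => |(X * p₁).eval x| / (x * |(X ^ 2 * r₁).eval x|))
        (fun y hy => by obtain ⟨hy0, hry⟩ := hT y hy; positivity) hx
    have h1 : |(X * p₁).eval x| ≤ S * (x * |(X ^ 2 * r₁).eval x|) := (div_le_iff₀ hden).mp hterm
    have h2 : c * (S * (x * |(X ^ 2 * r₁).eval x|)) < x * |(X ^ 2 * r₁).eval x| := by
      rw [hc]
      have : 1 / (2 * (1 + S)) * S < 1 := by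
        rw [div_mul_eq_mul_div, one_mul, div_lt_one (by positivity)]; linarith
      nlinarith
    calc c * |(X * p₁).eval x| ≤ c * (S * (x * |(X ^ 2 * r₁).eval x|)) := mul_le_mul_of_nonneg_left h1 hcpos.le
      _ < x * |(X ^ 2 * r₁).eval x| := h2
  -- near `0`: the ratio `x² r₁(x)/p₁(x)` is small and `p₁` keeps its sign
  have hg : ContinuousAt (fun x : ℝ => x ^ 2 * r₁.eval x / p₁.eval x) 0 :=
    (((continuous_pow 2).mul r₁.continuous).continuousAt).div p₁.continuous.continuousAt hp₁
  have hg0 : (fun x : ℝ => x ^ 2 * r₁.eval x / p₁.eval x) 0 = 0 := by simp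
  have hev1 : ∀ᶠ x in 𝓝 (0 : ℝ), |x ^ 2 * r₁.eval x / p₁.eval x| < c := by
    have h := (Metric.tendsto_nhds.mp hg) c hcpos
    filter_upwards [h] with x hx
    have e0 : (0 : ℝ) ^ 2 * r₁.eval 0 / p₁.eval 0 = 0 := by simp
    have hx' : dist (x ^ 2 * r₁.eval x / p₁.eval x) ((0 : ℝ) ^ 2 * r₁.eval 0 / p₁.eval 0) < c := hx
    rw [e0, Real.dist_eq, sub_zero] at hx'
    exact hx'
  have hev2 : ∀ᶠ x in 𝓝 (0 : ℝ), 0 < p₁.eval 0 * p₁.eval x := by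
    have hc2 : ContinuousAt (fun x : ℝ => p₁.eval 0 * p₁.eval x) 0 :=
      (continuous_const.mul p₁.continuous).continuousAt
    exact continuousAt_const.eventually_lt hc2 (by simpa using mul_self_pos.mpr hp₁)
  obtain ⟨δ, hδ, hδP⟩ := Metric.eventually_nhds_iff.mp (hev1.and hev2)
  set Q : ℝ := min δ m₀ / 2 with hQ
  have hQpos : 0 < Q := by rw [hQ]; positivity
  have hQδ : Q < δ := by
    rw [hQ]; have := min_le_left δ m₀; linarith
  have hQm : Q < m₀ := by
    rw [hQ]; have := min_le_right δ m₀; linarith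
  obtain ⟨hQ1, hQ2⟩ := hδP (by rw [Real.dist_eq, sub_zero, abs_of_pos hQpos]; exact hQδ)
  refine ⟨c, Q, hcpos, hQpos, hQm, hsmall, ?_, hQ2⟩
  have hp₁Q : p₁.eval Q ≠ 0 := by
    intro h; rw [h, mul_zero] at hQ2; exact lt_irrefl 0 hQ2
  have h1 : |Q ^ 2 * r₁.eval Q| < c * |p₁.eval Q| := by
    rw [abs_div, div_lt_iff₀ (abs_pos.mpr hp₁Q)] at hQ1; exact hQ1
  have e1 : Q * |(X ^ 2 * r₁).eval Q| = Q * |Q ^ 2 * r₁.eval Q| := by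
    rw [eval_mul, eval_pow, eval_X]
  have e2 : c * |(X * p₁).eval Q| = Q * (c * |p₁.eval Q|) := by
    rw [eval_mul, eval_X, abs_mul, abs_of_pos hQpos]; ring
  rw [e1, e2]
  exact mul_lt_mul_of_pos_left h1 hQpos

/-! ## 2. Sign bookkeeping and list plumbing -/

/-- If `|b| < |a|` then `a − b` has the sign of `a`. [folklore] -/
theorem sub_mul_self_pos_of_abs_lt {a b : ℝ} (h : |b| < |a|) : 0 < (a - b) * a := by
  rcases le_or_gt 0 a with ha | ha
  · rw [abs_of_nonneg ha] at h
    have hb : b < a := lt_of_le_of_lt (le_abs_self b) h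
    have ha' : 0 < a := lt_of_le_of_lt (abs_nonneg b) h
    nlinarith
  · rw [abs_of_neg ha] at h
    have hb : -a > -b := lt_of_le_of_lt (neg_le_abs b) h
    nlinarith

/-- If `|a| < |b|` then `a − b` has the sign of `−b`. [folklore] -/
theorem sub_mul_neg_of_abs_lt {a b : ℝ} (h : |a| < |b|) : (a - b) * b < 0 := by
  have := sub_mul_self_pos_of_abs_lt (a := b) (b := a) h
  nlinarith

/-- Appending one point to a chain. [list plumbing] -/
theorem isChain_append_singleton {R : ℝ → ℝ → Prop} : ∀ {L : List ℝ} (hL : L ≠ []) {P : ℝ},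
    L.IsChain R → R (L.getLast hL) P → (L ++ [P]).IsChain R
  | [], hL, _, _, _ => absurd rfl hL
  | [a], _, P, _, hR => by simpa using hR
  | a :: b :: l, _, P, h, hR => by
    rw [List.cons_append, List.cons_append]
    have h1 : R a b := (List.isChain_cons_cons.mp h).1
    have h2 : (b :: l).IsChain R := (List.isChain_cons_cons.mp h).2
    have hlast : (a :: b :: l).getLast (by simp) = (b :: l).getLast (by simp) := List.getLast_cons (by simp)
    rw [hlast] at hR
    have ih := isChain_append_singleton (L := b :: l) (by simp) h2 hR
    rw [List.cons_append] at ih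
    exact List.isChain_cons_cons.mpr ⟨h1, ih⟩

/-! ## 3. The two steps on sign chains -/

/-- **STEP AT `+∞`.**  `p` alternates along a chain `L` of positive points, `p(last L)` has the sign of `lc p`, `lc p ~ lc q`, `deg(X p) < deg(X⁴ q)`.  Then for some
`c > 0` and `P > last L`, `r = X·p − c·X⁴·q` alternates along `L ++ [P]`, copies the sign of `p` on `L`, and `r(P) ≁ q(P) ~ lc q`. [this file] -/
theorem step_top (p q : ℝ[X]) (hq : q ≠ 0) (hdeg : (X * p).degree < (X ^ 4 * q).degree)
    (hlc : 0 < p.leadingCoeff * q.leadingCoeff) (L : List ℝ) (hL : L ≠ [])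
    (hch : L.IsChain (· < ·)) (hpos : ∀ x ∈ L, 0 < x) (halt : L.IsChain (fun x y => p.eval x * p.eval y < 0))
    (hne : ∀ x ∈ L, p.eval x ≠ 0) (hlast : 0 < p.leadingCoeff * p.eval (L.getLast hL)) :
    ∃ c P : ℝ, 0 < c ∧ L.getLast hL < P ∧ 0 < P ∧
      (L ++ [P]).IsChain (· < ·) ∧ (∀ x ∈ L ++ [P], 0 < x) ∧
      (L ++ [P]).IsChain (fun x y => (X * p - C c * X ^ 4 * q).eval x * (X * p - C c * X ^ 4 * q).eval y < 0) ∧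
      (∀ x ∈ L, 0 < (X * p - C c * X ^ 4 * q).eval x * p.eval x) ∧
      (X * p - C c * X ^ 4 * q).eval P * q.eval P < 0 ∧ 0 < q.leadingCoeff * q.eval P := by
  classical
  obtain ⟨c, P, hc, hMP, hP0, hsmall, hbig, hsgn⟩ :=
    exists_coeff_top p q hq hdeg L.toFinset (fun x hx => ⟨hpos x (List.mem_toFinset.mp hx), hne x (List.mem_toFinset.mp hx)⟩)
      (L.getLast hL)
  set r : ℝ[X] := X * p - C c * X ^ 4 * q with hr
  have hr_eval : ∀ x, r.eval x = x * p.eval x - c * x ^ 4 * q.eval x := by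
    intro x; simp only [hr, eval_sub, eval_mul, eval_X, eval_C, eval_pow]
  -- signs copied on `L`
  have hcopy : ∀ x ∈ L, 0 < r.eval x * p.eval x := by
    intro x hx
    have hx0 := hpos x hx
    have h := hsmall x (List.mem_toFinset.mpr hx)
    have habs : |c * x ^ 4 * q.eval x| < |x * p.eval x| := by
      rw [abs_mul, abs_mul, abs_of_pos hc, abs_of_pos (pow_pos hx0 4), abs_mul, abs_of_pos hx0]; exact h
    have h1 := sub_mul_self_pos_of_abs_lt habs
    rw [hr_eval]
    have e : (x * p.eval x - c * x ^ 4 * q.eval x) * (x * p.eval x) = x * ((x * p.eval x - c * x ^ 4 * q.eval x) * p.eval x) := by ring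
    rw [e] at h1
    exact pos_of_mul_pos_right h1 hx0.le
  -- the new point
  have hrP : r.eval P * q.eval P < 0 := by
    have habs : |P * p.eval P| < |c * P ^ 4 * q.eval P| := by
      rw [abs_mul, abs_of_pos hP0, abs_mul, abs_mul, abs_of_pos hc, abs_of_pos (pow_pos hP0 4)]; exact hbig
    have h1 := sub_mul_neg_of_abs_lt habs
    rw [hr_eval]
    have e : (P * p.eval P - c * P ^ 4 * q.eval P) * (c * P ^ 4 * q.eval P) =
        (c * P ^ 4) * ((P * p.eval P - c * P ^ 4 * q.eval P) * q.eval P) := by ring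
    rw [e] at h1
    have hcP : 0 < c * P ^ 4 := by positivity
    by_contra hcon
    push Not at hcon
    nlinarith [mul_nonneg hcP.le hcon]
  refine ⟨c, P, hc, hMP, hP0, ?_, ?_, ?_, hcopy, hrP, hsgn⟩
  · exact isChain_append_singleton hL hch hMP
  · intro x hx
    rcases List.mem_append.mp hx with hx | hx
    · exact hpos x hx
    · rw [List.mem_singleton.mp hx]; exact hP0
  · have hL' : L.IsChain (fun x y => r.eval x * r.eval y < 0) :=
      (isChain_alt_congr (c := 1) (f := fun x => r.eval x) (g := fun x => p.eval x)
        (fun x hx => by simpa using hcopy x hx)).mpr halt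
    refine isChain_append_singleton hL hL' ?_
    -- `r(last) ~ p(last) ~ lc p ~ lc q ~ q(P) ≁ r(P)`
    have h1 : 0 < r.eval (L.getLast hL) * p.eval (L.getLast hL) := hcopy _ (List.getLast_mem hL)
    have h2 : 0 < r.eval (L.getLast hL) * p.leadingCoeff := mul_pos_of_mul_pos_of_mul_pos h1 (by rw [mul_comm]; exact hlast)
    have h3 : 0 < r.eval (L.getLast hL) * q.leadingCoeff := mul_pos_of_mul_pos_of_mul_pos h2 hlc
    have h4 : 0 < r.eval (L.getLast hL) * q.eval P := mul_pos_of_mul_pos_of_mul_pos h3 hsgn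
    exact mul_neg_of_mul_pos_of_mul_neg h4 (by rw [mul_comm]; exact hrP)

/-- **STEP AT `0⁺`.**  `r = X²·r₁` alternates along a chain `x₀ :: L` of positive points, `r(x₀) ~ p₁(0)` where `p = X·p₁`, `p₁(0) ≠ 0`.  Then for some `c > 0`
and `0 < Q < x₀`, `s = X·r − c·p` alternates along `Q :: x₀ :: L`, copies the sign of `r` on `x₀ :: L`, and `s(Q) ≁ p₁(0)`. [this file] -/
theorem step_bot (p₁ r₁ : ℝ[X]) (hp₁ : p₁.eval 0 ≠ 0) (x₀ : ℝ) (L : List ℝ)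
    (hch : (x₀ :: L).IsChain (· < ·)) (hpos : ∀ x ∈ x₀ :: L, 0 < x)
    (halt : (x₀ :: L).IsChain (fun x y => (X ^ 2 * r₁).eval x * (X ^ 2 * r₁).eval y < 0))
    (hne : ∀ x ∈ x₀ :: L, (X ^ 2 * r₁).eval x ≠ 0) (hhead : 0 < p₁.eval 0 * (X ^ 2 * r₁).eval x₀) :
    ∃ c Q : ℝ, 0 < c ∧ 0 < Q ∧ Q < x₀ ∧
      (Q :: x₀ :: L).IsChain (· < ·) ∧ (∀ x ∈ Q :: x₀ :: L, 0 < x) ∧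
      (Q :: x₀ :: L).IsChain (fun x y => (X * (X ^ 2 * r₁) - C c * (X * p₁)).eval x * (X * (X ^ 2 * r₁) - C c * (X * p₁)).eval y < 0) ∧
      (∀ x ∈ x₀ :: L, 0 < (X * (X ^ 2 * r₁) - C c * (X * p₁)).eval x * (X ^ 2 * r₁).eval x) ∧
      (X * (X ^ 2 * r₁) - C c * (X * p₁)).eval Q * p₁.eval 0 < 0 := by
  classical
  have hx₀pos : 0 < x₀ := hpos x₀ (by simp)
  obtain ⟨c, Q, hc, hQ0, hQx, hsmall, hbig, hsgn⟩ :=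
    exists_coeff_bot p₁ r₁ hp₁ (x₀ :: L).toFinset
      (fun x hx => ⟨hpos x (List.mem_toFinset.mp hx), hne x (List.mem_toFinset.mp hx)⟩) x₀ hx₀pos
  set r : ℝ[X] := X ^ 2 * r₁ with hr
  set p : ℝ[X] := X * p₁ with hp
  set s : ℝ[X] := X * r - C c * p with hs
  have hs_eval : ∀ x, s.eval x = x * r.eval x - c * p.eval x := by
    intro x; simp only [hs, eval_sub, eval_mul, eval_X, eval_C]
  have hcopy : ∀ x ∈ x₀ :: L, 0 < s.eval x * r.eval x := by
    intro x hx
    have hx0 := hpos x hx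
    have h := hsmall x (List.mem_toFinset.mpr hx)
    have habs : |c * p.eval x| < |x * r.eval x| := by
      rw [abs_mul, abs_of_pos hc, abs_mul, abs_of_pos hx0]; exact h
    have h1 := sub_mul_self_pos_of_abs_lt habs
    rw [hs_eval]
    have e : (x * r.eval x - c * p.eval x) * (x * r.eval x) = x * ((x * r.eval x - c * p.eval x) * r.eval x) := by ring
    rw [e] at h1
    exact pos_of_mul_pos_right h1 hx0.le
  have hsQ : s.eval Q * p₁.eval 0 < 0 := by
    have habs : |Q * r.eval Q| < |c * p.eval Q| := by
      rw [abs_mul, abs_of_pos hQ0, abs_mul, abs_of_pos hc]; exact hbig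
    have h1 := sub_mul_neg_of_abs_lt habs   -- (Q r Q − c p Q) * (c p Q) < 0
    rw [hs_eval]
    have hpQ : p.eval Q = Q * p₁.eval Q := by simp [hp, eval_mul, eval_X]
    rw [hpQ] at h1 ⊢
    have e : (Q * r.eval Q - c * (Q * p₁.eval Q)) * (c * (Q * p₁.eval Q)) =
        (c * Q) * ((Q * r.eval Q - c * (Q * p₁.eval Q)) * p₁.eval Q) := by ring
    rw [e] at h1
    have hcQ : 0 < c * Q := mul_pos hc hQ0
    have h2 : (Q * r.eval Q - c * (Q * p₁.eval Q)) * p₁.eval Q < 0 := by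
      by_contra hcon; push Not at hcon; nlinarith [mul_nonneg hcQ.le hcon]
    exact mul_neg_of_mul_neg_of_mul_pos h2 (by rw [mul_comm]; exact hsgn)
  refine ⟨c, Q, hc, hQ0, hQx, ?_, ?_, ?_, hcopy, hsQ⟩
  · exact List.isChain_cons_cons.mpr ⟨hQx, hch⟩
  · intro x hx
    rcases List.mem_cons.mp hx with rfl | hx
    · exact hQ0
    · exact hpos x hx
  · have hL' : (x₀ :: L).IsChain (fun x y => s.eval x * s.eval y < 0) :=
      (isChain_alt_congr (c := 1) (f := fun x => s.eval x) (g := fun x => r.eval x)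
        (fun x hx => by simpa using hcopy x hx)).mpr halt
    refine List.isChain_cons_cons.mpr ⟨?_, hL'⟩
    -- `s(Q) ≁ p₁(0) ~ r(x₀) ~ s(x₀)`
    have h1 : 0 < s.eval x₀ * r.eval x₀ := hcopy x₀ (by simp)
    have h2 : 0 < s.eval x₀ * p₁.eval 0 := mul_pos_of_mul_pos_of_mul_pos h1 (by rw [mul_comm]; exact hhead)
    have h3 := mul_neg_of_mul_pos_of_mul_neg h2 (by rw [mul_comm]; exact hsQ)
    rw [mul_comm] at h3; exact h3

end SlopeSumRow

end Summit.ValiantsHypothesis.ValiantsHypothesis.Theorems.KPlusLogSqLaw
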